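import Mathlib

/-!
# STUB-IDEAS k3 g10 — `stub_heegnerIndexLowerAtTwo` (crux `PrintCf2.SplitBadTwoLowerHalfOfFacts`, item 27851)

TECHNIQUE = decomposition with PROVED glue.  Node = STUB-PLAN v2.4 row 19/24, the located gap **G1** of
road B (T1-AT, k1-g7): «INTEGRAL rank-one ε-isomorphism at `v` over `Λ(G)`, `G = Gal(K(E[2^∞])_v/ℚ₂) ∋ −1`,
`p = 2`» — sized research-S (`stub_epsilonIntegralAtV`, valuation shadow `∀ N, 0 ≤ δ N`) by k2-g8 / R58.

This sketch types the decomposition  G1 ⟸ E1 ∧ E2 ∧ E3 ∧ E4  at the level the anchors consume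
(valuations of LATTICES, not units of `Λ̃`), proves the glue, and proves three dyadic digit laws that the
currency row E4 and the unramified row E2 quote.  Mathlib only; every `E·` is a `Prop`-valued field, cited
by page in the card.  Nothing here proves the stub, the crux, or BSD.

* E1  `latticeCyc`  — Burns–Flach 2006 Prop 5.2 + Thm 1.1 at `p = 2` (Λ = ℤ₂[G_{N₀·4}]⟦T⟧ ∋ −1, tame level
        `N₀`): the Λ-adic local determinant `Det_Λ⁻¹ RΓ(ℚ₂, 𝕋)` is generated by the Coleman/Perrin-Riou basis;
        finite-level exact constants by the descent §6 (23)–(24); Flach 2011 completes `r ≤ 0`.  PRINT.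
* E2  `latticeUnr`  — the same statement with the unramified `ℤ₂`-direction `H` adjoined
        (`Λ' = Λ⟦H⟧`, relative Lubin–Tate / Perrin-Riou Lemma 1.5 over `W(𝔽̄₂)`): research-XS/S, template = BF §5
        verbatim (Λ' is still semilocal Cohen–Macaulay; the torsion modules' supports still avoid 2).
* E3  `descends`    — χ-component extraction / specialisation `Λ' → ℤ₂[χ_fin](η·χ_cyc^r)` at each anchor
        (BF (23): `Det` commutes with `⊗^L`), bookkeeping.
* E4  `currency`    — the anchor's BF unit `u` of (24) (Euler factors `e_p(1 − Fr_p/p)`, `e_p(1 − p^{r−1}Fr_p⁻¹)`,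
        Gauss sum, `(r−1)!`) equals de Shalit (37)'s local data (`n_v(k − ½)` prefactor, `G(ε)`, Γ-digit)
        digit by digit — the B16 ledger row, bookkeeping but sign-critical.
-/

set_option linter.dupNamespace false

namespace Summit.BirchSwinnertonDyer.BirchSwinnertonDyer.Cruxes.SplitBadTwoLowerHalfOfFacts.HeegnerIndexTwo.K3G10

/-! ### §A.  The G1 ledger at the anchors and the proved glue -/

/-- Per-anchor local digits at the place `v ∣ 2` of `K₀ = ℚ(√−7)` (all `ord₂`, integers).
`cole N`  = index digit of the Coleman/Perrin-Riou basis image against `H¹(ℚ₂, T(ε_{N,v}))/tors`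
           (what E1 ∧ E2 ∧ E3 assert to be `0`);
`eulA N`, `epsA N`, `gamA N` = Euler-factor, ε/Gauss-sum and Γ digits on the ALGEBRAIC (Bloch–Kato / BF (24)) side;
`eulK N`, `epsK N`, `gamK N`, `pref N` = the same three digits and the `n_v(k_N − ½)` prefactor on the
ANALYTIC (Katz / de Shalit (36)–(37)) side;  `grow N` = the common growth term of k2-g8 §C. -/
structure AnchorLedger where
  cole : ℕ → ℤ
  eulA : ℕ → ℤ
  epsA : ℕ → ℤ
  gamA : ℕ → ℤ
  eulK : ℕ → ℤ
  epsK : ℕ → ℤ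
  gamK : ℕ → ℤ
  pref : ℕ → ℤ
  grow : ℕ → ℤ

namespace AnchorLedger

variable (L : AnchorLedger)

/-- Algebraic local digit at the anchor `N` (k2-g8's `al N − B`). -/
def al (N : ℕ) : ℤ := L.cole N + L.eulA N + L.epsA N + L.gamA N + L.grow N

/-- Analytic local digit at the anchor `N` (k2-g8's `an N − A`); the prefactor `pref` of (37) is
ABSORBED into `epsK + gamK` by E4 (it is the `p`-power part of the Gauss sum and of the period
normalisation), so it enters with BOTH signs and cancels — typed, not assumed: see `currency`. -/
def an (N : ℕ) : ℤ := L.eulK N + L.epsK N + L.gamK N + L.grow N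

/-- The defect of k2-g8 §C: `δ N = al N − an N`. -/
def defect (N : ℕ) : ℤ := L.al N - L.an N

/-- E1 ∧ E2 ∧ E3 at the anchors: the lattice is generated by the Coleman basis after descent. -/
def LatticeGenerated (N₀ : ℕ) : Prop := ∀ N, N₀ ≤ N → L.cole N = 0

/-- E4, the currency row: BF (24) digits = de Shalit (37) digits, term by term. -/
def Currency (N₀ : ℕ) : Prop :=
  ∀ N, N₀ ≤ N → L.eulA N = L.eulK N ∧ L.epsA N = L.epsK N ∧ L.gamA N = L.gamK N

/-- **GLUE 1 (proved).**  E1–E4 ⟹ the defect vanishes at every anchor `N ≥ N₀` — the hypothesis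
`hmatch` of k2-g8's `const_indep_of_local_match`, hence BOTH one-sided versions with `Δ = 0`. -/
theorem defect_eq_zero {N₀ : ℕ} (hlat : L.LatticeGenerated N₀) (hcur : L.Currency N₀) :
    ∀ N, N₀ ≤ N → L.defect N = 0 := by
  intro N hN
  have h1 := hlat N hN
  obtain ⟨h2, h3, h4⟩ := hcur N hN
  simp only [defect, al, an]
  omega

/-- **GLUE 2 (proved): three customers at once.**  With `an N = A + (analytic digits)` and
`al N = B + (algebraic digits)` as in k2-g8 §C, a vanishing defect gives the EXACT level-free transported
constant `al − an = B − A` (two-sided): the LOWER child reads `B − A ≤ al N − an N`, the UPPER sibling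
(item 27850) reads `al N − an N ≤ B − A` (k2-g8's `upper_of_bounded_defect` with `Δ = 0`), and the parent
(item 20368, road α/B two-sided anchor identity `m − 2n = e_M′`) reads the equality. -/
theorem customers {N₀ : ℕ} {A B : ℤ} {anT alT : ℕ → ℤ}
    (han : ∀ N, anT N = A + L.an N) (hal : ∀ N, alT N = B + L.al N)
    (hlat : L.LatticeGenerated N₀) (hcur : L.Currency N₀) :
    ∀ N, N₀ ≤ N → (B - A ≤ alT N - anT N ∧ alT N - anT N ≤ B - A ∧ alT N - anT N = B - A) := by
  intro N hN
  have h0 := L.defect_eq_zero hlat hcur N hN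
  have h1 := han N
  have h2 := hal N
  simp only [defect] at h0
  refine ⟨?_, ?_, ?_⟩ <;> omega

/-- **GLUE 3 (proved): what survives if only E1 ∧ E3 ∧ E4 are booked and E2 is left as a one-sided
research residue `0 ≤ cole N`** (Coleman INTEGRALITY in the unramified direction without the cokernel
control): exactly k2-g8's LOWER-only shape `B − A ≤ al − an`.  Direction audit: this is the sign the
LOWER child needs ONLY IF `cole` is booked on the algebraic side with THIS sign; the card asks the critic
to re-audit P-B1 «INTO suffices» against BF (24) (there `u ∈ ℤ₂[G]` alone is NOT the theorem —
`u ∈ ℤ₂[G]ˣ` is). -/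
theorem lower_only {N₀ : ℕ} {A B : ℤ} {anT alT : ℕ → ℤ}
    (han : ∀ N, anT N = A + L.an N) (hal : ∀ N, alT N = B + L.al N)
    (hint : ∀ N, N₀ ≤ N → 0 ≤ L.cole N) (hcur : L.Currency N₀) :
    ∀ N, N₀ ≤ N → B - A ≤ alT N - anT N := by
  intro N hN
  have h0 := hint N hN
  obtain ⟨h2, h3, h4⟩ := hcur N hN
  have h5 := han N
  have h6 := hal N
  simp only [al, an] at h5 h6
  omega

end AnchorLedger

/-! ### §B.  Three dyadic digit laws quoted by E4 and E2 (proved; B13 made explicit)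

At `p = 2` NO Euler factor at `s` with `Re` near the edge is a unit «by inspection» (battery B13).  The
two factors of BF (24) / de Shalit (36) at an anchor of weight `r = k_N ≥ 2` and unramified parameter
`u ∈ ℤ₂ˣ` are `1 − 2^{r−1}u⁻¹`-type (a UNIT, `euler_high_isUnit`) and `1 − u/2`-type (valuation EXACTLY
`−1` on both sides, `euler_low_val`) — they cancel in the defect only because E4 books them on both
sides.  `unr_converges` is the digit law of the unramified direction E2: the anchors' unramified
parameters `η⋆(Frob)·u^{2^N}` converge 2-adically (`2^{N+2} ∣ u^{2^N} − 1`, `N ≥ 1`), so E2 is needed for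
ONE infinite-order unramified character `η⋆` up to a `2^{N+2}`-small perturbation, not for a family. -/

/-- `1 − 2^{r−1}·u` is odd for `r ≥ 2`: the «high» Euler factor is a 2-adic unit. -/
theorem euler_high_isUnit (u : ℤ) (r : ℕ) (hr : 2 ≤ r) : padicValInt 2 (1 - 2 ^ (r - 1) * u) = 0 := by
  apply padicValInt.eq_zero_of_not_dvd
  intro h
  have hx : (2 : ℤ) ∣ 2 ^ (r - 1) * u :=
    Dvd.dvd.mul_right (dvd_pow_self 2 (by omega)) u
  have h1 : (2 : ℤ) ∣ (1 - 2 ^ (r - 1) * u) + 2 ^ (r - 1) * u := dvd_add h hx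
  have h2 : (1 - 2 ^ (r - 1) * u) + 2 ^ (r - 1) * u = (1 : ℤ) := by ring
  rw [h2] at h1
  norm_num at h1

/-- `1 − u/2 = (2 − u)/2` has 2-adic valuation EXACTLY `−1` for odd `u`: the «low» Euler factor is never
a unit at `2` (B13), on either side. -/
theorem euler_low_val (u : ℤ) (hu : Odd u) : padicValRat 2 ((1 : ℚ) - u / 2) = -1 := by
  have hodd : ¬ (2 : ℤ) ∣ (2 - u) := by
    intro h
    obtain ⟨m, hm⟩ := hu
    omega
  have hne : (2 - u : ℤ) ≠ 0 := by
    intro h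
    obtain ⟨m, hm⟩ := hu
    omega
  have hrew : ((1 : ℚ) - u / 2) = ((2 - u : ℤ) : ℚ) / (2 : ℕ) := by
    push_cast
    ring
  rw [hrew, padicValRat.div (by exact_mod_cast hne) (by norm_num), padicValRat.of_int,
    padicValInt.eq_zero_of_not_dvd hodd]
  have : padicValRat 2 ((2 : ℕ) : ℚ) = 1 := by
    exact_mod_cast padicValRat.self (p := 2) (by norm_num)
  rw [this]
  norm_num

/-- The unramified direction converges: `2^{N+2} ∣ u^{2^N} − 1` for odd `u` and `N ≥ 1`. -/
theorem unr_converges (u : ℤ) (hu : Odd u) : ∀ N : ℕ, 1 ≤ N → (2 : ℤ) ^ (N + 2) ∣ u ^ (2 ^ N) - 1 := by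
  intro N hN
  induction N with
  | zero => omega
  | succ n ih =>
    rcases Nat.eq_zero_or_pos n with h0 | hpos
    · subst h0
      obtain ⟨m, rfl⟩ := hu
      have h8 : (2 * m + 1 : ℤ) ^ (2 ^ (0 + 1)) - 1 = 4 * (m * (m + 1)) := by ring
      rw [h8]
      have h2 : (2 : ℤ) ∣ m * (m + 1) := (Int.even_mul_succ_self m).two_dvd
      obtain ⟨k, hk⟩ := h2
      rw [hk]
      exact ⟨k, by ring⟩
    · have ih' := ih hpos
      have hsplit : u ^ (2 ^ (n + 1)) - 1 = (u ^ (2 ^ n) - 1) * (u ^ (2 ^ n) + 1) := by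
        rw [pow_succ, pow_mul]
        ring
      rw [hsplit, show n + 1 + 2 = (n + 2) + 1 from by omega, pow_succ]
      apply mul_dvd_mul ih'
      have hoddpow : Odd (u ^ (2 ^ n)) := hu.pow
      obtain ⟨m, hm⟩ := hoddpow
      exact ⟨m + 1, by rw [hm]; ring⟩

/-! ### §C.  PLAN 2 glue — R2 (twisted in-range control at the anchors) split as R2a ∧ R2b

R2a (algebra, provable now from the LEAD's N-free datum `D` with (R-TOP′) «no finite submodule»):
`ord₂ #(X/(γ − u^{2^N})X) = ord₂ H(a_N)` — specialisation of the characteristic series at the twist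
(change of variable `T ↦ T − a_N`, an automorphism of `ℤ₂⟦T⟧` since `‖a_N‖ < 1`).
R2b (twisted Greenberg/Poitou–Tate control at level `K₀`, FINITE both sides because `γ` acts by
`u^{2^N} ≠ 1` — no Mordell–Weil term, no surjectivity defect δ of the rank-one specialisation):
`ord₂ #(X/(γ − u^{2^N})X) = s_N + cM_N` with `s_N` the twisted restricted Selmer length and `cM_N`
explicit local digits obeying the `N + 2` law of `unr_converges`.  Glue: -/

theorem twisted_control_of_split {ordQuot ordH s cM : ℕ → ℤ} {N₀ : ℕ}
    (hR2a : ∀ N, N₀ ≤ N → ordQuot N = ordH N) (hR2b : ∀ N, N₀ ≤ N → ordQuot N = s N + cM N) :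
    ∀ N, N₀ ≤ N → ordH N = s N + cM N := by
  intro N hN
  rw [← hR2a N hN, hR2b N hN]

end Summit.BirchSwinnertonDyer.BirchSwinnertonDyer.Cruxes.SplitBadTwoLowerHalfOfFacts.HeegnerIndexTwo.K3G10
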